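import Summits.AtomisticToContinuum.Crystallization.Theorems.FrustratedLawDichotomyStrainedPatchHomEntrySemanticQuotA

/-!
# Strained patch, (H) hcp root over the D₃ₕ point-group quotient «HomEntrySemanticQuot» (lens-5 NODE 88) — part 2 of 3 (sequel of `…FrustratedLawDichotomyStrainedPatchHomEntrySemanticQuotA`)

Split for the 400-line cap by the landing lane (hand-2 g39); the module docstring of part 1 (`…FrustratedLawDichotomyStrainedPatchHomEntrySemanticQuotA`) describes the whole node.  Same namespace; all FQNs unchanged.
0 sorry; standard axioms.
-/

noncomputable section

namespace Summit.AtomisticToContinuum.Crystallization.Theorems.FrustratedLawDichotomyStrainedPatchHomEntrySemanticQuot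

open scoped BigOperators RealInnerProductSpace
open Literature.Analysis.ValidatedNumerics.Numerics
open Summit.AtomisticToContinuum.Crystallization.Theorems.ChargedEnergyGapNegative (E3)
open Summit.AtomisticToContinuum.Crystallization.Theorems.FrustratedLawDichotomySchurCut (effPot w₄₅ ω₄)
open Summit.AtomisticToContinuum.Crystallization.Theorems.FrustratedLawDichotomyAveragingRuleTightFree (TightNearCap BadNearCap)
open Summit.AtomisticToContinuum.Crystallization.Theorems.FrustratedLawDichotomyExemptAbsorption (ExemptNear)
open Summit.AtomisticToContinuum.Crystallization.Theorems.FrustratedLawDichotomyStrainedPatchHomSplit (ExRec latPt hexFrame hcpShift HomFloor)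
open Summit.AtomisticToContinuum.Crystallization.Theorems.FrustratedLawDichotomyStrainedPatchHomCover (shuffle_mem_rootCube)
open Summit.AtomisticToContinuum.Crystallization.Theorems.FrustratedLawDichotomyStrainedPatchHomPrunedPolar (homFloor_of_prunedBoxSums_selfAdjoint)
open Summit.AtomisticToContinuum.Crystallization.Theorems.FrustratedLawDichotomyStrainedPatchHomCertTree (CertTree treeOK)
open Summit.AtomisticToContinuum.Crystallization.Theorems.FrustratedLawDichotomyStrainedPatchHomEntryGram (rootC rootW rootW_div mem_root_of_near_one)
open Summit.AtomisticToContinuum.Crystallization.Theorems.FrustratedLawDichotomyStrainedPatchHomEntryGramHcp (rootCH rootWH)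
open Summit.AtomisticToContinuum.Crystallization.Theorems.FrustratedLawDichotomyStrainedPatchHomEntrySignKit (flipIso flipIso_apply flip_entry conjIso_selfAdjoint conjIso_pos conjIso_norm_sub_one_le)
open Summit.AtomisticToContinuum.Crystallization.Theorems.FrustratedLawDichotomyStrainedPatchHomEntryFlipHcp (HcpDich hcpDich_of_flip)
open Summit.AtomisticToContinuum.Crystallization.Theorems.FrustratedLawDichotomyStrainedPatchHomEntryMirrorHcpKit (mirIso mirIso_apply)
open Summit.AtomisticToContinuum.Crystallization.Theorems.FrustratedLawDichotomyStrainedPatchHomEntryMirrorHcp (hcpDich_of_mir)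
open Summit.AtomisticToContinuum.Crystallization.Theorems.FrustratedLawDichotomyStrainedPatchHomEntryLeafHT (hcpCoord HcpLeafGoal inHcpBox_iff hcpLeafGoal_mono semOKH semOKH_forall semOKH_of_sound abs_sub_div_le_of_contained abs_sub_div_le_or_of_cut entryLeafOK6RBKP4 fccHalf_of_entryTree6RBKP4 hcpHalf_of_semOKH)

/-! ## §4. Vacuous leaves: outside the sector, outside the ball -/

/-- One scaled coordinate: membership `|x − c/SC| ≤ w/SC` is `c − w ≤ x·SC ≤ c + w`. [arithmetic] -/
theorem scaled_mem {x : ℝ} {c w : ℤ} (hx : |x - (c : ℝ) / SC| ≤ (w : ℝ) / SC) : (c : ℝ) - w ≤ x * SC ∧ x * SC ≤ (c : ℝ) + w := by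
  have hS : (0 : ℝ) < SC := SC_pos
  rw [abs_sub_le_iff] at hx
  obtain ⟨h1, h2⟩ := hx
  have h1' := mul_le_mul_of_nonneg_right h1 hS.le
  have h2' := mul_le_mul_of_nonneg_right h2 hS.le
  rw [sub_mul, div_mul_cancel₀ _ hS.ne', div_mul_cancel₀ _ hS.ne'] at h1'
  rw [sub_mul, div_mul_cancel₀ _ hS.ne', div_mul_cancel₀ _ hS.ne'] at h2'
  constructor <;> linarith

/-- ★ **SECTOR PRUNE**: the box lies outside `Σ` throughout — `ξ₁ > 0` on the box, or `ξ₀` has a sign on the box and `ξ₀² > 3 ξ₁²` at the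
extreme corner (`|ξ₀| ≥ min |ξ₀|`, `|ξ₁| ≤ w₁ − c₁` on `ξ₁ ≤ 0`). -/
def sectorOut (c w : (Fin 3 × Fin 3) ⊕ Fin 3 → ℤ) : Bool :=
  decide (0 < c (Sum.inr 1) - w (Sum.inr 1)) ||
    (decide (0 < c (Sum.inr 0) - w (Sum.inr 0)) && decide (3 * (w (Sum.inr 1) - c (Sum.inr 1)) ^ 2 < (c (Sum.inr 0) - w (Sum.inr 0)) ^ 2)) ||
    (decide (c (Sum.inr 0) + w (Sum.inr 0) < 0) && decide (3 * (w (Sum.inr 1) - c (Sum.inr 1)) ^ 2 < (c (Sum.inr 0) + w (Sum.inr 0)) ^ 2))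

/-- Soundness of the sector prune: no point of the box lies in `Σ`. [arithmetic] -/
theorem false_of_sectorOut {c w : (Fin 3 × Fin 3) ⊕ Fin 3 → ℤ} (h : sectorOut c w = true) {ξ : E3}
    (hξ : ∀ i : Fin 3, |ξ i - (c (Sum.inr i) : ℝ) / SC| ≤ (w (Sum.inr i) : ℝ) / SC) (hb : ξ 1 ≤ 0) (hab : (ξ 0) ^ 2 ≤ 3 * (ξ 1) ^ 2) : False := by
  have hS : (0 : ℝ) < SC := SC_pos
  obtain ⟨l0, u0⟩ := scaled_mem (hξ 0)
  obtain ⟨l1, u1⟩ := scaled_mem (hξ 1)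
  have hb' : ξ 1 * SC ≤ 0 := mul_nonpos_of_nonpos_of_nonneg hb hS.le
  have hab' : (ξ 0 * SC) ^ 2 ≤ 3 * (ξ 1 * SC) ^ 2 := by
    have h3 := mul_le_mul_of_nonneg_right hab (sq_nonneg (SC : ℝ))
    have e1 : (ξ 0 * SC) ^ 2 = (ξ 0) ^ 2 * (SC : ℝ) ^ 2 := by ring
    have e2 : 3 * (ξ 1 * SC) ^ 2 = 3 * (ξ 1) ^ 2 * (SC : ℝ) ^ 2 := by ring
    rw [e1, e2]; exact h3
  have hx1sq : (ξ 1 * SC) ^ 2 ≤ ((w (Sum.inr 1) : ℝ) - c (Sum.inr 1)) ^ 2 := by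
    nlinarith [mul_nonneg (by linarith : (0 : ℝ) ≤ (w (Sum.inr 1) : ℝ) - c (Sum.inr 1) + ξ 1 * SC)
      (by linarith : (0 : ℝ) ≤ (w (Sum.inr 1) : ℝ) - c (Sum.inr 1) - ξ 1 * SC)]
  simp only [sectorOut, Bool.or_eq_true, Bool.and_eq_true, decide_eq_true_eq] at h
  rcases h with (h | ⟨h0, hlt⟩) | ⟨h0, hlt⟩
  · have h' : (0 : ℝ) < (c (Sum.inr 1) : ℝ) - w (Sum.inr 1) := by exact_mod_cast h
    linarith
  · have h0' : (0 : ℝ) < (c (Sum.inr 0) : ℝ) - w (Sum.inr 0) := by exact_mod_cast h0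
    have hlt' : (3 : ℝ) * ((w (Sum.inr 1) : ℝ) - c (Sum.inr 1)) ^ 2 < ((c (Sum.inr 0) : ℝ) - w (Sum.inr 0)) ^ 2 := by exact_mod_cast hlt
    have hx0sq : ((c (Sum.inr 0) : ℝ) - w (Sum.inr 0)) ^ 2 ≤ (ξ 0 * SC) ^ 2 := by
      nlinarith [mul_nonneg (by linarith : (0 : ℝ) ≤ ξ 0 * SC - ((c (Sum.inr 0) : ℝ) - w (Sum.inr 0)))
        (by linarith : (0 : ℝ) ≤ ξ 0 * SC + ((c (Sum.inr 0) : ℝ) - w (Sum.inr 0)))]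
    linarith
  · have h0' : (c (Sum.inr 0) : ℝ) + w (Sum.inr 0) < 0 := by exact_mod_cast h0
    have hlt' : (3 : ℝ) * ((w (Sum.inr 1) : ℝ) - c (Sum.inr 1)) ^ 2 < ((c (Sum.inr 0) : ℝ) + w (Sum.inr 0)) ^ 2 := by exact_mod_cast hlt
    have hx0sq : ((c (Sum.inr 0) : ℝ) + w (Sum.inr 0)) ^ 2 ≤ (ξ 0 * SC) ^ 2 := by
      nlinarith [mul_nonneg (by linarith : (0 : ℝ) ≤ -(ξ 0 * SC) + ((c (Sum.inr 0) : ℝ) + w (Sum.inr 0)))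
        (by linarith : (0 : ℝ) ≤ -(ξ 0 * SC) - ((c (Sum.inr 0) : ℝ) + w (Sum.inr 0)))]
    linarith

/-- ★ A box outside the sector is certified VACUOUSLY at every level. [formal bookkeeping] -/
theorem semOKHQ_of_sectorOut {μ : ℤ} {c w : (Fin 3 × Fin 3) ⊕ Fin 3 → ℤ} (h : sectorOut c w = true) : semOKHQ μ c w = true :=
  semOKHQ_of_forall fun U ξ _ _ _ _ hmem hb hab => (false_of_sectorOut h ((inHcpBox_iff c w U ξ).1 hmem).2 hb hab).elim

/-- ★ **BALL PRUNE** (new — enabled by the `‖ξ‖ ≤ 1/4` hypothesis): the box lies outside the ball `‖ξ‖ ≤ 1/4` throughout: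
`16 · Σᵢ (max 0 (|cᵢ| − wᵢ))² > SC²`. -/
def ballOut (c w : (Fin 3 × Fin 3) ⊕ Fin 3 → ℤ) : Bool :=
  decide ((SC : ℤ) ^ 2 < 16 * ((max 0 (|c (Sum.inr 0)| - w (Sum.inr 0))) ^ 2 + (max 0 (|c (Sum.inr 1)| - w (Sum.inr 1))) ^ 2 +
    (max 0 (|c (Sum.inr 2)| - w (Sum.inr 2))) ^ 2))

/-- One coordinate: `max 0 (|c| − w) ≤ |x| · SC` on the box. [arithmetic] -/
theorem max_le_abs_scaled {x : ℝ} {c w : ℤ} (hx : |x - (c : ℝ) / SC| ≤ (w : ℝ) / SC) : ((max 0 (|c| - w) : ℤ) : ℝ) ≤ |x| * SC := by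
  have hS : (0 : ℝ) < SC := SC_pos
  obtain ⟨l, u⟩ := scaled_mem hx
  have h2 : |(c : ℝ) - x * SC| ≤ w := by rw [abs_sub_le_iff]; constructor <;> linarith
  have h3 := abs_sub_abs_le_abs_sub (c : ℝ) (x * SC)
  have h4 : |x * (SC : ℝ)| = |x| * SC := by rw [abs_mul, abs_of_pos hS]
  have h1 : |(c : ℝ)| - w ≤ |x| * SC := by linarith [h3, h2, h4.symm.le, h4.le]
  have h0 : (0 : ℝ) ≤ |x| * SC := by positivity
  rw [Int.cast_max, Int.cast_zero, Int.cast_sub, Int.cast_abs]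
  exact max_le h0 h1

/-- Soundness of the ball prune. [arithmetic] -/
theorem false_of_ballOut {c w : (Fin 3 × Fin 3) ⊕ Fin 3 → ℤ} (h : ballOut c w = true) {ξ : E3}
    (hξ : ∀ i : Fin 3, |ξ i - (c (Sum.inr i) : ℝ) / SC| ≤ (w (Sum.inr i) : ℝ) / SC) (hn : ‖ξ‖ ≤ 1 / 4) : False := by
  have hS : (0 : ℝ) < SC := SC_pos
  simp only [ballOut, decide_eq_true_eq] at h
  have h' : ((SC : ℤ) : ℝ) ^ 2 < 16 * ((((max 0 (|c (Sum.inr 0)| - w (Sum.inr 0))) : ℤ) : ℝ) ^ 2 +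
      (((max 0 (|c (Sum.inr 1)| - w (Sum.inr 1))) : ℤ) : ℝ) ^ 2 + (((max 0 (|c (Sum.inr 2)| - w (Sum.inr 2))) : ℤ) : ℝ) ^ 2) := by
    exact_mod_cast h
  have hSC : ((SC : ℤ) : ℝ) = (SC : ℝ) := by norm_cast
  rw [hSC] at h'
  have p0 : (0 : ℝ) ≤ (((max 0 (|c (Sum.inr 0)| - w (Sum.inr 0))) : ℤ) : ℝ) := by
    exact_mod_cast (le_max_left 0 _ : (0 : ℤ) ≤ max 0 (|c (Sum.inr 0)| - w (Sum.inr 0)))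
  have p1 : (0 : ℝ) ≤ (((max 0 (|c (Sum.inr 1)| - w (Sum.inr 1))) : ℤ) : ℝ) := by
    exact_mod_cast (le_max_left 0 _ : (0 : ℤ) ≤ max 0 (|c (Sum.inr 1)| - w (Sum.inr 1)))
  have p2 : (0 : ℝ) ≤ (((max 0 (|c (Sum.inr 2)| - w (Sum.inr 2))) : ℤ) : ℝ) := by
    exact_mod_cast (le_max_left 0 _ : (0 : ℤ) ≤ max 0 (|c (Sum.inr 2)| - w (Sum.inr 2)))
  have t : ∀ i : Fin 3, (((max 0 (|c (Sum.inr i)| - w (Sum.inr i))) : ℤ) : ℝ) ^ 2 ≤ (ξ i) ^ 2 * (SC : ℝ) ^ 2 := by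
    intro i
    have q := max_le_abs_scaled (hξ i)
    have p : (0 : ℝ) ≤ (((max 0 (|c (Sum.inr i)| - w (Sum.inr i))) : ℤ) : ℝ) := by
      exact_mod_cast (le_max_left 0 _ : (0 : ℤ) ≤ max 0 (|c (Sum.inr i)| - w (Sum.inr i)))
    have s := mul_self_le_mul_self p q
    have a : |ξ i| * |ξ i| = (ξ i) ^ 2 := by rw [← sq, sq_abs]
    calc (((max 0 (|c (Sum.inr i)| - w (Sum.inr i))) : ℤ) : ℝ) ^ 2
        = (((max 0 (|c (Sum.inr i)| - w (Sum.inr i))) : ℤ) : ℝ) * (((max 0 (|c (Sum.inr i)| - w (Sum.inr i))) : ℤ) : ℝ) := sq _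
      _ ≤ |ξ i| * SC * (|ξ i| * SC) := s
      _ = (|ξ i| * |ξ i|) * (SC : ℝ) ^ 2 := by ring
      _ = (ξ i) ^ 2 * (SC : ℝ) ^ 2 := by rw [a]
  -- `‖ξ‖² = ξ₀² + ξ₁² + ξ₂²`
  have hnorm : ‖ξ‖ ^ 2 = (ξ 0) ^ 2 + (ξ 1) ^ 2 + (ξ 2) ^ 2 := by
    rw [EuclideanSpace.norm_eq, Real.sq_sqrt (Finset.sum_nonneg fun i _ => by positivity), Fin.sum_univ_three]
    simp only [Real.norm_eq_abs, sq_abs]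
  have hn2 : ‖ξ‖ ^ 2 ≤ (1 / 4) ^ 2 := pow_le_pow_left₀ (norm_nonneg _) hn 2
  have hn3 : ‖ξ‖ ^ 2 * (SC : ℝ) ^ 2 ≤ (1 / 4) ^ 2 * (SC : ℝ) ^ 2 := mul_le_mul_of_nonneg_right hn2 (sq_nonneg _)
  rw [hnorm] at hn3
  have t0 := t 0
  have t1 := t 1
  have t2 := t 2
  nlinarith [t0, t1, t2, hn3, h']

/-- ★ A box outside the ball is certified VACUOUSLY at every level. [formal bookkeeping] -/
theorem semOKHQ_of_ballOut {μ : ℤ} {c w : (Fin 3 × Fin 3) ⊕ Fin 3 → ℤ} (h : ballOut c w = true) : semOKHQ μ c w = true :=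
  semOKHQ_of_forall fun U ξ _ _ _ hξn hmem _ _ => (false_of_ballOut h ((inHcpBox_iff c w U ξ).1 hmem).2 hξn).elim

/-! ## §4b. Trees over the quotient: any verdict whose accepted boxes are `semOKHQ` facts, with the two vacuous prunes in front -/

/-- ★ A box accepted by ANY verdict sound in the QUOTIENT shape (hypotheses: self-adjoint, positive, `‖U − 1‖ ≤ 1/4`, `‖ξ‖ ≤ 1/4`, box, `ξ ∈ Σ`;
no `ξ₀ / ξ₂` signs) is a `semOKHQ` fact — the entry point for a future SIGN-FREE production verdict (one kernel evaluation per orbit).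
[formal bookkeeping] -/
theorem semOKHQ_of_sound {μ : ℤ} (verdict : ((Fin 3 × Fin 3) ⊕ Fin 3 → ℤ) → ((Fin 3 × Fin 3) ⊕ Fin 3 → ℤ) → Bool)
    (hver : ∀ c w, verdict c w = true → ∀ (U : E3 →L[ℝ] E3) (ξ : E3), (∀ v v' : E3, ⟪U v, v'⟫ = ⟪v, U v'⟫) → (∀ v : E3, 0 ≤ ⟪v, U v⟫) →
      ‖U - 1‖ ≤ 1 / 4 → ‖ξ‖ ≤ 1 / 4 →
      (∀ ab : Fin 3 × Fin 3, |(U (EuclideanSpace.single ab.2 (1 : ℝ))) ab.1 - (c (Sum.inl ab) : ℝ) / SC| ≤ (w (Sum.inl ab) : ℝ) / SC) →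
      (∀ i : Fin 3, |ξ i - (c (Sum.inr i) : ℝ) / SC| ≤ (w (Sum.inr i) : ℝ) / SC) → ξ 1 ≤ 0 → (ξ 0) ^ 2 ≤ 3 * (ξ 1) ^ 2 → HcpLeafGoal μ U ξ)
    {c w : (Fin 3 × Fin 3) ⊕ Fin 3 → ℤ} (h : verdict c w = true) : semOKHQ μ c w = true :=
  semOKHQ_of_forall fun U ξ hsa hpos hU hξ hmem hb hab =>
    hver c w h U ξ hsa hpos hU hξ ((inHcpBox_iff c w U ξ).1 hmem).1 ((inHcpBox_iff c w U ξ).1 hmem).2 hb hab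

/-- The QUOTIENT LEAF built from any box verdict `v`: the two vacuous prunes first, then `v`. -/
def quotLeaf (v : ((Fin 3 × Fin 3) ⊕ Fin 3 → ℤ) → ((Fin 3 × Fin 3) ⊕ Fin 3 → ℤ) → Bool) (c w : (Fin 3 × Fin 3) ⊕ Fin 3 → ℤ) : Bool :=
  sectorOut c w || ballOut c w || v c w

/-- Soundness of the quotient leaf from the (semantic) soundness of `v`. [formal bookkeeping] -/
theorem semOKHQ_of_quotLeaf {μ : ℤ} {v : ((Fin 3 × Fin 3) ⊕ Fin 3 → ℤ) → ((Fin 3 × Fin 3) ⊕ Fin 3 → ℤ) → Bool}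
    (hv : ∀ c w, v c w = true → semOKHQ μ c w = true) {c w : (Fin 3 × Fin 3) ⊕ Fin 3 → ℤ} (h : quotLeaf v c w = true) :
    semOKHQ μ c w = true := by
  simp only [quotLeaf, Bool.or_eq_true] at h
  rcases h with (h | h) | h
  · exact semOKHQ_of_sectorOut h
  · exact semOKHQ_of_ballOut h
  · exact hv c w h

/-- ★ **EVERY CERTIFICATE TREE over a verdict whose accepted boxes are `semOKHQ` facts is ONE `semOKHQ` fact on its root box** (leaves by
hypothesis, splits by `semOKHQ_of_halves`) — e.g. over `quotLeaf v`, over `semOKHQ μ` itself, or over a table of landed cells. [formal bookkeeping] -/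
theorem semOKHQ_of_treeOK {μ : ℤ} (verdict : ((Fin 3 × Fin 3) ⊕ Fin 3 → ℤ) → ((Fin 3 × Fin 3) ⊕ Fin 3 → ℤ) → Bool)
    (hv : ∀ c w, verdict c w = true → semOKHQ μ c w = true) :
    ∀ (t : CertTree ((Fin 3 × Fin 3) ⊕ Fin 3)) (c w : (Fin 3 × Fin 3) ⊕ Fin 3 → ℤ), treeOK verdict t c w = true → semOKHQ μ c w = true
  | .leaf, c, w, h => hv c w (by simpa [treeOK] using h)
  | .split k l r, c, w, h => by
    simp only [treeOK, Bool.and_eq_true, decide_eq_true_eq] at h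
    exact semOKHQ_of_halves k h.1.1 (semOKHQ_of_treeOK verdict hv l _ _ h.1.2) (semOKHQ_of_treeOK verdict hv r _ _ h.2)

/-- GUARDED TRANSFER of a kernel-evaluated tree to another verdict: if `v₁ ∧ g ⇒ v₂` box-wise, a tree accepted by `v₁` whose boxes ALSO pass the
(cheap) guard tree `treeOK g t` is accepted by `v₂` — e.g. `v₁` = the production verdict, `g c w := !shufOut c w` («no leaf was accepted by the sign
prune»), `v₂` = its quotient-shape port: old cell trees are re-validated for the quotient by ONE cheap kernel evaluation of the guard tree, not of the
fit tests. [formal bookkeeping: induction on the tree] -/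
theorem treeOK_of_guard {κ : Type} [DecidableEq κ] {v₁ g v₂ : (κ → ℤ) → (κ → ℤ) → Bool} (hv : ∀ c w, v₁ c w = true → g c w = true → v₂ c w = true) :
    ∀ (t : CertTree κ) (c w : κ → ℤ), treeOK v₁ t c w = true → treeOK g t c w = true → treeOK v₂ t c w = true
  | .leaf, c, w, h, hg => hv c w (by simpa [treeOK] using h) (by simpa [treeOK] using hg)
  | .split k l r, c, w, h, hg => by
    simp only [treeOK, Bool.and_eq_true] at h hg ⊢
    exact ⟨⟨h.1.1, treeOK_of_guard hv l _ _ h.1.2 hg.1.2⟩, treeOK_of_guard hv r _ _ h.2 hg.2⟩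

/-! ## §5. Conversions from landed `semOKH` facts -/

/-- One coordinate: a box with `c − w ≥ 0` has `x ≥ 0` at every point. [arithmetic] -/
theorem nonneg_of_mem {x : ℝ} {c w : ℤ} (hcw : 0 ≤ c - w) (hx : |x - (c : ℝ) / SC| ≤ (w : ℝ) / SC) : 0 ≤ x := by
  have hS : (0 : ℝ) < SC := SC_pos
  obtain ⟨l, -⟩ := scaled_mem hx
  have h' : (0 : ℝ) ≤ (c : ℝ) - w := by exact_mod_cast hcw
  nlinarith

/-- ★ A landed `semOKH` box lying inside `{ξ₀ ≥ 0, ξ₂ ≥ 0}` (`c₀ − w₀ ≥ 0`, `c₂ − w₂ ≥ 0`) IS a `semOKHQ` box. [formal bookkeeping] -/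
theorem semOKHQ_of_semOKH_pos {μ : ℤ} {c w : (Fin 3 × Fin 3) ⊕ Fin 3 → ℤ} (h0 : 0 ≤ c (Sum.inr 0) - w (Sum.inr 0))
    (h2 : 0 ≤ c (Sum.inr 2) - w (Sum.inr 2)) (h : semOKH μ c w = true) : semOKHQ μ c w = true :=
  semOKHQ_of_forall fun U ξ hsa _ hU _ hmem _ _ =>
    semOKH_forall h U ξ hsa hU hmem (nonneg_of_mem h0 (by simpa [hcpCoord] using hmem (Sum.inr 0)))
      (nonneg_of_mem h2 (by simpa [hcpCoord] using hmem (Sum.inr 2)))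

/-- An OLD-shape sound verdict (hypotheses `0 ≤ ξ₀`, `0 ≤ ξ₂`, as every landed hcp verdict: v3, v4, `entryLeafOKHQDCRS`, …) certifies, in the
quotient currency, every accepted box lying inside the `(+,+)` quadrant (`c₀ − w₀ ≥ 0`, `c₂ − w₂ ≥ 0`). [formal bookkeeping] -/
theorem semOKHQ_of_sound_pos {μ : ℤ} (verdict : ((Fin 3 × Fin 3) ⊕ Fin 3 → ℤ) → ((Fin 3 × Fin 3) ⊕ Fin 3 → ℤ) → Bool)
    (hver : ∀ c w, verdict c w = true → ∀ (U : E3 →L[ℝ] E3) (ξ : E3), (∀ v v' : E3, ⟪U v, v'⟫ = ⟪v, U v'⟫) → ‖U - 1‖ ≤ 1 / 4 →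
      (∀ ab : Fin 3 × Fin 3, |(U (EuclideanSpace.single ab.2 (1 : ℝ))) ab.1 - (c (Sum.inl ab) : ℝ) / SC| ≤ (w (Sum.inl ab) : ℝ) / SC) →
      (∀ i : Fin 3, |ξ i - (c (Sum.inr i) : ℝ) / SC| ≤ (w (Sum.inr i) : ℝ) / SC) → 0 ≤ ξ 0 → 0 ≤ ξ 2 → HcpLeafGoal μ U ξ)
    {c w : (Fin 3 × Fin 3) ⊕ Fin 3 → ℤ} (h0 : 0 ≤ c (Sum.inr 0) - w (Sum.inr 0)) (h2 : 0 ≤ c (Sum.inr 2) - w (Sum.inr 2))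
    (h : verdict c w = true) : semOKHQ μ c w = true :=
  semOKHQ_of_semOKH_pos h0 h2 (semOKH_of_sound verdict hver h)

/-- The sign `ε_a` of the flip `Fᵢ` on coordinate `a`: `−1` if `a = i`, else `1`. -/
def sgnF (i a : Fin 3) : ℤ := if a = i then -1 else 1

/-- `ε_a` as a real number is the `if` of `…SignKit.flip_entry`. [formal bookkeeping] -/
theorem sgnF_cast (i a : Fin 3) : ((sgnF i a : ℤ) : ℝ) = if a = i then (-1 : ℝ) else 1 := by
  unfold sgnF; split_ifs <;> simp

/-- `ε_a ∈ {1, −1}`. [formal bookkeeping] -/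
theorem sgnF_cases (i a : Fin 3) : (if a = i then (-1 : ℝ) else 1) = 1 ∨ (if a = i then (-1 : ℝ) else 1) = -1 := by
  split_ifs <;> simp

/-- The FLIPPED BOX CENTRE under `Fᵢ`: entries `c_ab ↦ ε_a ε_b c_ab` (`ε_i = −1`), shuffle `c_i ↦ −c_i`; half-widths unchanged. -/
def flipC (i : Fin 3) (c : (Fin 3 × Fin 3) ⊕ Fin 3 → ℤ) : (Fin 3 × Fin 3) ⊕ Fin 3 → ℤ :=
  Sum.elim (fun ab => sgnF i ab.1 * sgnF i ab.2 * c (Sum.inl ab)) (fun j => if j = i then -c (Sum.inr j) else c (Sum.inr j))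

/-- `|ε_a ε_b u − ε_a ε_b v| = |u − v|` for signs `ε_a, ε_b = ±1`. [arithmetic] -/
theorem abs_signs_mul_sub (εa εb u v : ℝ) (ha : εa = 1 ∨ εa = -1) (hb : εb = 1 ∨ εb = -1) :
    abs (εa * εb * u - εa * εb * v) = abs (u - v) := by
  have h1 : abs εa = 1 := by rcases ha with h | h <;> simp [h]
  have h2 : abs εb = 1 := by rcases hb with h | h <;> simp [h]
  rw [← mul_sub, abs_mul, abs_mul, h1, h2, one_mul, one_mul]

/-- ★ The flipped pair `(Fᵢ U Fᵢ, Fᵢ ξ)` lies in the flipped box. [formal bookkeeping] -/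
theorem mem_flipC (i : Fin 3) {c w : (Fin 3 × Fin 3) ⊕ Fin 3 → ℤ} {U : E3 →L[ℝ] E3} {ξ : E3}
    (hmem : ∀ k, |hcpCoord U ξ k - (c k : ℝ) / SC| ≤ (w k : ℝ) / SC) :
    ∀ k, |hcpCoord ((flipIso i : E3 →L[ℝ] E3).comp (U.comp ((flipIso i).symm : E3 →L[ℝ] E3))) (flipIso i ξ) k - (flipC i c k : ℝ) / SC| ≤
      (w k : ℝ) / SC := by
  intro k
  rcases k with ab | j
  · have h := hmem (Sum.inl ab)
    simp only [hcpCoord, Sum.elim_inl] at h ⊢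
    rw [flip_entry]
    simp only [flipC, Sum.elim_inl]
    push_cast
    rw [sgnF_cast, sgnF_cast, mul_div_assoc, abs_signs_mul_sub _ _ _ _ (sgnF_cases i ab.1) (sgnF_cases i ab.2)]
    exact h
  · have h := hmem (Sum.inr j)
    simp only [hcpCoord, Sum.elim_inr] at h ⊢
    rw [flipIso_apply]
    simp only [flipC, Sum.elim_inr]
    by_cases hj : j = i
    · rw [if_pos hj, if_pos hj]
      push_cast
      rw [show -ξ j - -(c (Sum.inr j) : ℝ) / SC = -(ξ j - (c (Sum.inr j) : ℝ) / SC) by ring, abs_neg]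
      exact h
    · rw [if_neg hj, if_neg hj]
      exact h

/-- ★★ **FOUR-FACT ASSEMBLY (the transport the old currency lacked)**: the `semOKH` facts at a box and at its three flipped images
(`F₀`, `F₂`, `F₀F₂`) give the `semOKHQ` fact at the box — each `(ξ₀, ξ₂)`-sign quadrant of the box is the `(+,+)` quadrant of one image,
transported back by §1. [folklore] -/
theorem semOKHQ_of_semOKH_quad {μ : ℤ} {c w : (Fin 3 × Fin 3) ⊕ Fin 3 → ℤ} (h : semOKH μ c w = true) (hF0 : semOKH μ (flipC 0 c) w = true)
    (hF2 : semOKH μ (flipC 2 c) w = true) (hF02 : semOKH μ (flipC 0 (flipC 2 c)) w = true) : semOKHQ μ c w = true := by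
  refine semOKHQ_of_forall fun U ξ hsa hpos hU hξ hmem _ _ => ?_
  obtain ⟨a0, -, a2⟩ := flip0_coords ξ
  obtain ⟨b0, -, b2⟩ := flip2_coords ξ
  rcases le_or_gt 0 (ξ 2) with h2 | h2
  · rcases le_or_gt 0 (ξ 0) with h0 | h0
    · exact semOKH_forall h U ξ hsa hU hmem h0 h2
    · -- `F₀`
      obtain ⟨s1, -, n1⟩ := conj_data (flipIso 0) hsa hpos hU
      refine hcpLeafGoal_of_flip (Or.inl rfl) U ξ hU hξ (semOKH_forall hF0 _ _ s1 n1 (mem_flipC 0 hmem) ?_ ?_)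
      · rw [a0]; linarith
      · rw [a2]; exact h2
  · rcases le_or_gt 0 (ξ 0) with h0 | h0
    · -- `F₂`
      obtain ⟨s1, -, n1⟩ := conj_data (flipIso 2) hsa hpos hU
      refine hcpLeafGoal_of_flip (Or.inr rfl) U ξ hU hξ (semOKH_forall hF2 _ _ s1 n1 (mem_flipC 2 hmem) ?_ ?_)
      · rw [b0]; exact h0
      · rw [b2]; linarith
    · -- `F₀ F₂`
      obtain ⟨s1, p1, n1⟩ := conj_data (flipIso 2) hsa hpos hU
      obtain ⟨s2, -, n2⟩ := conj_data (flipIso 0) s1 p1 n1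
      have hξ1 := norm_iso_le (flipIso 2) hξ
      obtain ⟨c0, -, c2⟩ := flip0_coords (flipIso 2 ξ)
      refine hcpLeafGoal_of_flip (Or.inr rfl) U ξ hU hξ
        (hcpLeafGoal_of_flip (Or.inl rfl) _ _ n1 hξ1 (semOKH_forall hF02 _ _ s2 n2 (mem_flipC 0 (mem_flipC 2 hmem)) ?_ ?_))
      · rw [c0, b0]; linarith
      · rw [c2, b2]; linarith

/-- ★ CONTAINMENT: the OLD root fact `semOKH μ rootCH rootWH` gives EVERY `semOKHQ` fact (the old root certifies every admissible pair).
[formal bookkeeping] -/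
theorem semOKHQ_of_semOKH_root {μ : ℤ} (h : semOKH μ rootCH rootWH = true) (c w : (Fin 3 × Fin 3) ⊕ Fin 3 → ℤ) : semOKHQ μ c w = true := by
  refine semOKHQ_of_forall fun U ξ hsa hpos hU hξ _ _ _ => ?_
  have hS : (0 : ℝ) < SC := SC_pos
  have hμ : 2 * ((μ : ℝ) / SC / 2 - (-(7175 / 10000) + 3 / 400) + (-(7175 / 10000) + 3 / 400)) * SC ≤ μ := by
    rw [show 2 * ((μ : ℝ) / SC / 2 - (-(7175 / 10000) + 3 / 400) + (-(7175 / 10000) + 3 / 400)) * SC = (μ : ℝ) / SC * SC by ring,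
      div_mul_cancel₀ _ hS.ne']
  exact (hcpLeafGoal_iff_hcpDich μ U ξ).2 (hcpHalf_of_semOKH hμ h U ξ hsa hpos hU hξ)

end Summit.AtomisticToContinuum.Crystallization.Theorems.FrustratedLawDichotomyStrainedPatchHomEntrySemanticQuot

end
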